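import Summits.SmoothPoincare4.SmoothPoincare4.Theorems.ConvexBisectionAcyclicBisectionExistsDualHandleGluingCollars
import Summits.SmoothPoincare4.SmoothPoincare4.Theorems.ConvexBisectionAcyclicBisectionExistsDualHandleBeltMap
import HarnessLib

/-!
# Dual handles, X: the standard form of a closed gluing around the belt circles of a sub-family
(brick (ii-d) of the sub-goal T3b "the complement of the prefix sub-handlebody is the other piece
with the DUAL suffix handles" of stub `stub_steinRealisation` (NF6), line `modp-braid-orbits` r11,
crux `ConvexBisection.AcyclicBisectionExists`, item stmt-SmoothPoincare4-10508; wave 2, lead c5)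

One-statement packaging of `…DualHandleGluingCollars.lean` for the provers of the long pole of T3b:
given a multi-attachment `X = B ∪_{h̄} (handles)` (data `D`, `X` compact), a closed gluing
`M = X ∪_Ψ W` and an injective sub-family `f : ι' ↪ ι` of handles (the suffix handles), there are

* Milnor's gluing datum `G = ⟨CM, CN, Ψ⟩` whose open collar `G.CM` of `∂X` is ADAPTED to all the
  belt maps `beltMap D (f j')` with one constant `a > 0` (the hypothesis `hCM` of
  `modelChart_of_norm_le_one`, `…SeamModelChart.lean`),
* a collar `col` of the canonical boundary datum of `W` MATCHED with `G.CN` (the hypothesis `hcol`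
  of `jN_dualMap_eq_modelChart`, `…SeamModelDual.lean`) — the collar along which the dual attaching
  maps `dualMap D bX bW Ψ col κ δ …` are to be prolonged,
* and a diffeomorphism `M ≅ G.d₂.Glued` (uniqueness of gluings),

so that the three conjuncts of `node_dual_presentation` may be proved for `G.d₂.Glued` (and the
first pulled back by `isBoundaryGluing_of_diffeomorph`).  Everything here is proved; no named facts.

## References
* J. Milnor, *Lectures on the h-cobordism theorem* (1965), Thm. 1.4, §3. [MilnorHCobordism1965]
* M. W. Hirsch, *Differential Topology* (1976), Ch. 8 §2, Thm. 2.1. [HirschDT1976]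
-/

noncomputable section

-- the prescribed namespace `Summit.<P>.<Sub>.…` duplicates `SmoothPoincare4` (P = Sub)
set_option linter.dupNamespace false

open scoped Manifold ContDiff Topology

namespace Summit.SmoothPoincare4.SmoothPoincare4.Theorems.AcyclicBisectionExists.ModpBraidOrbits

open Set Function Metric
open Literature.Topology.FourManifolds Literature.Topology.FourManifolds.HandleAttachingMap

/-- **The standard form of `M = X ∪_Ψ W` around the belt circles of a sub-family of handles.**
[cite: MilnorHCobordism1965, Thm. 1.4] -/
theorem exists_standardForm
    {B : Type} [TopologicalSpace B] [T2Space B] [ChartedSpace (EuclideanHalfSpace 4) B]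
    {ι : Type} [Finite ι] {h : ι → HandleAttachingMap 3 2 B}
    {X : Type} [TopologicalSpace X] [T2Space X] [CompactSpace X] [ChartedSpace (EuclideanHalfSpace 4) X]
    [IsManifold (𝓡∂ 4) ∞ X] (D : MultiAttachmentData h (𝓡∂ 4) X)
    {ι' : Type} [Finite ι'] (f : ι' → ι) (hf : Injective f)
    {W : Type} [TopologicalSpace W] [T2Space W] [CompactSpace W] [ChartedSpace (EuclideanHalfSpace 4) W]
    [IsManifold (𝓡∂ 4) ∞ W] (bX : BoundaryData (𝓡∂ 4) X (𝓡 3)) (bW : BoundaryData (𝓡∂ 4) W (𝓡 3))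
    [Nonempty bX.carrier] (Ψ : bX.carrier ≃ₘ⟮𝓡 3, 𝓡 3⟯ bW.carrier)
    {M : Type} [TopologicalSpace M] [ChartedSpace (EuclideanSpace ℝ (Fin 4)) M] [IsManifold (𝓡 4) ∞ M]
    (hglue : IsBoundaryGluing bX bW Ψ (𝓡 4) M) :
    ∃ (G : BoundaryGlueData bX bW) (a : ℝ) (col : (BoundaryManifold.boundaryData 3 W).Collar),
      G.φ = Ψ ∧ 0 < a ∧ Nonempty (M ≃ₘ⟮𝓡 4, 𝓡 4⟯ G.d₂.Glued) ∧
      (∀ (j' : ι') (θ : sphere (0 : EuclideanSpace ℝ (Fin 2)) 1) (v : EuclideanSpace ℝ (Fin 2)), ‖v‖ ≤ 1 / 2 →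
        ∀ z : bX.carrier, bX.incl z = (beltMap D (f j')).toFun (depthLine θ v 0) →
        ∀ s : ℝ, 0 ≤ s → collarStretch a s ≤ min (1 / 5) a →
          G.CM.toFun z s = (beltMap D (f j')).toFun (depthLine θ v (collarStretch a s))) ∧
      (∀ (w : (BoundaryManifold.boundaryData 3 W).carrier) (x : bW.carrier),
        (BoundaryManifold.boundaryData 3 W).incl w = bW.incl x →
        ∀ t : Set.Icc (0 : ℝ) 1, col.toFun (w, t) = G.CN.toFun x ((t : ℝ) / (2 - t))) := by
  have hdisj : Pairwise fun i j => Disjoint (range (beltMap D (f i)).toFun) (range (beltMap D (f j)).toFun) :=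
    fun i j hij => pairwise_disjoint_range_beltMap D (hf.ne hij)
  obtain ⟨CM, a, ha, hCM⟩ := exists_openCollar_adapted (fun j' => beltMap D (f j')) hdisj bX
  haveI : Nonempty bW.carrier := ⟨Ψ (Classical.arbitrary _)⟩
  obtain ⟨CN, col, hcol⟩ := exists_openCollar_collar_eq bW
  exact ⟨⟨CM, CN, Ψ⟩, a, col, rfl, ha, exists_diffeomorph_glued Ψ hglue CM CN,
    fun j' θ v hv z hz s hs hcs => hCM j' θ v hv z hz s hs hcs, hcol⟩

/-- **Registered helper `helper_exists_standardForm` (brick (ii-d) of T3b, sub-goal of NF6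
`stub_steinRealisation`, wave 2, lead c5): the standard form of a closed gluing around the belt
circles of a sub-family of handles** (adapted open collar, matched collar, `M ≅ G.d₂.Glued`).
[cite: MilnorHCobordism1965, Thm. 1.4] -/
theorem helper_exists_standardForm : ∀ {B : Type} [TopologicalSpace B] [T2Space B] [ChartedSpace (EuclideanHalfSpace 4) B] {ι : Type} [Finite ι] {h : ι → Literature.Topology.FourManifolds.HandleAttachingMap 3 2 B} {X : Type} [TopologicalSpace X] [T2Space X] [CompactSpace X] [ChartedSpace (EuclideanHalfSpace 4) X] [IsManifold (𝓡∂ 4) ∞ X] (D : Literature.Topology.FourManifolds.HandleAttachingMap.MultiAttachmentData h (𝓡∂ 4) X) {ι' : Type} [Finite ι'] (f : ι' → ι), Function.Injective f → ∀ {W : Type} [TopologicalSpace W] [T2Space W] [CompactSpace W] [ChartedSpace (EuclideanHalfSpace 4) W] [IsManifold (𝓡∂ 4) ∞ W] (bX : Literature.Topology.FourManifolds.BoundaryData (𝓡∂ 4) X (𝓡 3)) (bW : Literature.Topology.FourManifolds.BoundaryData (𝓡∂ 4) W (𝓡 3)) [Nonempty bX.carrier] (Ψ : bX.carrier ≃ₘ⟮𝓡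 3, 𝓡 3⟯ bW.carrier) {M : Type} [TopologicalSpace M] [ChartedSpace (EuclideanSpace ℝ (Fin 4)) M] [IsManifold (𝓡 4) ∞ M], Literature.Topology.FourManifolds.IsBoundaryGluing bX bW Ψ (𝓡 4) M → ∃ (G : Literature.Topology.FourManifolds.BoundaryGlueData bX bW) (a : ℝ) (col : (Literature.Topology.FourManifolds.BoundaryManifold.boundaryData 3 W).Collar), G.φ = Ψ ∧ 0 < a ∧ Nonempty (M ≃ₘ⟮𝓡 4, 𝓡 4⟯ G.d₂.Glued) ∧ (∀ (j' : ι') (θ : Metric.sphere (0 : EuclideanSpace ℝ (Fin 2)) 1) (v : EuclideanSpace ℝ (Fin 2)), ‖v‖ ≤ 1 / 2 → ∀ z : bX.carrier, bX.incl z = (Summit.SmoothPoincare4.SmoothPoincare4.Theorems.AcyclicBisectionExists.ModpBraidOrbits.beltMap D (f j')).toFun (Literature.Topology.FourManifolds.depthLine θ v 0) → ∀ s : ℝ, 0 ≤ s → Literature.Topology.FourManifolds.collarStretch a s ≤ min (1 / 5) a → G.CM.toFun z s = (Summit.SmoothPoincare4.SmoothPoincare4.Theorems.AcyclicBisectionExists.ModpBraidOrbits.beltMap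 D (f j')).toFun (Literature.Topology.FourManifolds.depthLine θ v (Literature.Topology.FourManifolds.collarStretch a s))) ∧ (∀ (w : (Literature.Topology.FourManifolds.BoundaryManifold.boundaryData 3 W).carrier) (x : bW.carrier), (Literature.Topology.FourManifolds.BoundaryManifold.boundaryData 3 W).incl w = bW.incl x → ∀ t : Set.Icc (0 : ℝ) 1, col.toFun (w, t) = G.CN.toFun x ((t : ℝ) / (2 - t))) :=
  by
  intro B _ _ _ ι _ h X _ _ _ _ _ D ι' _ f hf W _ _ _ _ _ bX bW _ Ψ M _ _ _ hglue
  exact exists_standardForm D f hf bX bW Ψ hglue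

end Summit.SmoothPoincare4.SmoothPoincare4.Theorems.AcyclicBisectionExists.ModpBraidOrbits

end
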